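import Literature.NumberTheory.Sieve.PolymathGEHWindow
import HarnessLib

/-!
# Proposition 2.7: `GEH[ϑ]` for all `ϑ < 1` implies `EH[θ]` for all `θ < 1`

Trunk AntSieve, tooling toward the named fact `Literature.NumberTheory.Sieve.weakDHL_three_two_of_GEH`
(D. H. J. Polymath, Res. Math. Sci. 1:12 (2014) = arXiv:1407.4897, Theorem 3.2(xii)).
Proposition 2.7 of the paper (`GEH[ϑ] ⟹ EH[ϑ]`, "Vaughan's identity and dyadic decomposition",
p. 7), in the form consumed downstream: from `GEH[ϑ]` for every `0 < ϑ < 1` we get the tree's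
`EH θ` (`ParityWave0.lean`) for every `θ < 1` (`eh_of_forall_geh`) and hence
`PrimesHaveLevel θ` (`primesHaveLevel_of_forall_geh`, via the tree's `primesHaveLevel_of_forall_eh`).
The dyadic decomposition: `Δ(Λ; ⌊x⌋) = Σ_{i<I} [Δ(Λ; ⌊x/2^i⌋) − Δ(Λ; ⌊x/2^{i+1}⌋)] + Δ(Λ; ⌊x/2^I⌋)`
with `x/2^I ≍ x^κ`, `κ = 2θ/(1+θ)`; each window is `GEHtoEH.ehWindow_of_geh` at the point `x/2^i`
with level `(1+θ)/2`, the tail is trivial, and `ψ(x; q, a) − x/φ(q) = Δ(Λ; ⌊x⌋; a (q)) + (ψ_q(x) − x)/φ(q)`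
with `|ψ_q − ψ| ≤ ω(q) log x ≤ 2 log² x` and the prime number theorem.

## References

* [Polymath8b2014] D. H. J. Polymath, Res. Math. Sci. 1 (2014), Art. 12 = arXiv:1407.4897,
  Proposition 2.7 (p. 7).
-/

noncomputable section

open Finset Real Filter Asymptotics
open scoped ArithmeticFunction.vonMangoldt ArithmeticFunction.omega ArithmeticFunction.sigma

namespace Literature.NumberTheory.Sieve

namespace GEHtoEH

/-! ### `ψ(x; q, a)` versus `Δ(Λ; ⌊x⌋; a (q))` -/

/-- `ψ(x; q, a)` is the first sum of the discrepancy of `Λ` at `⌊x⌋`. [folklore] -/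
theorem chebyshevPsiMod_eq_sum_filter (q : ℕ) (a : ZMod q) (x : ℝ) :
    ParityWave0.chebyshevPsiMod q a x = ∑ n ∈ (Icc 1 ⌊x⌋₊).filter (fun n : ℕ => (n : ZMod q) = a), (Λ n : ℝ) := by
  unfold ParityWave0.chebyshevPsiMod
  rw [Finset.range_eq_Ico, Finset.sum_filter]
  have : Finset.Ico 0 (⌊x⌋₊ + 1) = insert 0 (Icc 1 ⌊x⌋₊) := by
    ext n; simp only [Finset.mem_Ico, Finset.mem_insert, Finset.mem_Icc]; omega
  rw [this, Finset.sum_insert (by simp)]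
  simp only [ArithmeticFunction.vonMangoldt.residueClass, Set.indicator_apply, Set.mem_setOf_eq,
    Nat.cast_zero, ArithmeticFunction.map_zero, ite_self, zero_add]

/-- `2^{ω(q)} ≤ q` for `q ≥ 1`. [folklore] -/
theorem two_pow_omega_le {q : ℕ} (hq : q ≠ 0) : 2 ^ ω q ≤ q := by
  rw [ArithmeticFunction.cardDistinctFactors_apply, ← List.card_toFinset, Nat.toFinset_factors]
  calc 2 ^ q.primeFactors.card = ∏ _p ∈ q.primeFactors, 2 := by rw [Finset.prod_const]
    _ ≤ ∏ p ∈ q.primeFactors, p := Finset.prod_le_prod' fun p hp => (Nat.prime_of_mem_primeFactors hp).two_le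
    _ ≤ q := Nat.le_of_dvd (Nat.pos_of_ne_zero hq) (Nat.prod_primeFactors_dvd q)

/-- `ω(q) ≤ 2 log q` for `q ≥ 1`. [folklore] -/
theorem omega_le_two_mul_log {q : ℕ} (hq : q ≠ 0) : (ω q : ℝ) ≤ 2 * Real.log q := by
  have h1 := two_pow_omega_le hq
  have h2 : (ω q : ℝ) * Real.log 2 ≤ Real.log q := by
    rw [← Real.log_pow]
    exact Real.log_le_log (by positivity) (by exact_mod_cast h1)
  have h3 := Real.log_two_gt_d9
  have h4 : 0 ≤ (ω q : ℝ) := Nat.cast_nonneg _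
  nlinarith

/-- **`ψ(x; q, a) − x/φ(q)` versus the discrepancy**: for `1 ≤ q ≤ x`,
`|ψ(x; q, a) − x/φ(q)| ≤ |Δ(Λ; ⌊x⌋; a (q))| + (|ψ(x) − x| + 2 (log x)²)/φ(q)`. [folklore] -/
theorem abs_chebyshevPsiMod_sub_le {q : ℕ} (hq : 1 ≤ q) (a : (ZMod q)ˣ) {x : ℝ} (hx : 1 ≤ x)
    (hqx : (q : ℝ) ≤ x) :
    |ParityWave0.chebyshevPsiMod q a x - x / Nat.totient q| ≤
      |apDiscrepancy (fun n => (Λ n : ℝ)) ⌊x⌋₊ q a| +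
        (|Chebyshev.psi x - x| + 2 * Real.log x ^ 2) / Nat.totient q := by
  have hφ0 : (0 : ℝ) < Nat.totient q := by exact_mod_cast Nat.totient_pos.2 (by omega)
  have hx0 : 0 < x := by linarith
  have hN1 : 1 ≤ ⌊x⌋₊ := Nat.le_floor (by simpa using hx)
  set S₂ := ∑ n ∈ (Icc 1 ⌊x⌋₊).filter (fun n : ℕ => n.Coprime q), (Λ n : ℝ) with hS₂
  have hΔ : apDiscrepancy (fun n => (Λ n : ℝ)) ⌊x⌋₊ q a =
      ParityWave0.chebyshevPsiMod q a x - S₂ / Nat.totient q := by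
    unfold apDiscrepancy; rw [chebyshevPsiMod_eq_sum_filter]
  have hψ : Chebyshev.psi x = ∑ n ∈ Icc 1 ⌊x⌋₊, (Λ n : ℝ) := by rw [Chebyshev.psi]; rfl
  have hsplit := Finset.sum_filter_add_sum_filter_not (Icc 1 ⌊x⌋₊) (fun n : ℕ => n.Coprime q) (fun n => (Λ n : ℝ))
  have hdiff : Chebyshev.psi x - S₂ = ∑ n ∈ (Icc 1 ⌊x⌋₊).filter (fun n : ℕ => ¬ n.Coprime q), (Λ n : ℝ) := by
    rw [hψ, hS₂, ← hsplit]; ring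
  have hd0 : 0 ≤ Chebyshev.psi x - S₂ := by
    rw [hdiff]; exact Finset.sum_nonneg fun _ _ => ArithmeticFunction.vonMangoldt_nonneg
  have hd1 : Chebyshev.psi x - S₂ ≤ 2 * Real.log x ^ 2 := by
    rw [hdiff]
    refine (sum_vonMangoldt_filter_not_coprime_le hq hN1).trans ?_
    have h1 : Real.log (⌊x⌋₊ : ℕ) ≤ Real.log x :=
      Real.log_le_log (by exact_mod_cast hN1) (Nat.floor_le hx0.le)
    have h2 := omega_le_two_mul_log (q := q) (by omega)
    have h3 : Real.log q ≤ Real.log x := Real.log_le_log (by exact_mod_cast hq) hqx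
    have hlogx : 0 ≤ Real.log x := Real.log_nonneg hx
    have hlogN : 0 ≤ Real.log (⌊x⌋₊ : ℕ) := Real.log_natCast_nonneg _
    have hω0 : 0 ≤ (ω q : ℝ) := Nat.cast_nonneg _
    calc (ω q : ℝ) * Real.log (⌊x⌋₊ : ℕ) ≤ (2 * Real.log x) * Real.log x :=
          mul_le_mul (h2.trans (by linarith)) h1 hlogN (by positivity)
      _ = 2 * Real.log x ^ 2 := by ring
  -- `ψ(x;q,a) - x/φ = Δ + (S₂ - x)/φ`
  have e : ParityWave0.chebyshevPsiMod q a x - x / Nat.totient q =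
      apDiscrepancy (fun n => (Λ n : ℝ)) ⌊x⌋₊ q a + (S₂ - x) / Nat.totient q := by
    rw [hΔ]; ring
  rw [e]
  refine (abs_add_le _ _).trans (add_le_add le_rfl ?_)
  rw [abs_div, abs_of_pos hφ0]
  refine div_le_div_of_nonneg_right ?_ hφ0.le
  have := abs_sub (S₂ - Chebyshev.psi x) (x - Chebyshev.psi x)
  have e2 : S₂ - x = (S₂ - Chebyshev.psi x) - (x - Chebyshev.psi x) := by ring
  rw [e2]
  refine this.trans ?_
  rw [abs_sub_comm x, abs_sub_comm S₂, abs_of_nonneg hd0]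
  linarith

/-! ### The dyadic decomposition -/

/-- `⌊(x/2^i)/2⌋ = ⌊x/2^{i+1}⌋`. [folklore] -/
theorem floor_half_pow (x : ℝ) (i : ℕ) : ⌊x / 2 ^ i / 2⌋₊ = ⌊x / 2 ^ (i + 1)⌋₊ := by
  rw [pow_succ, div_div]

/-- **Dyadic decomposition**: for every `I`,
`sup_a |Δ(Λ; ⌊x⌋)| ≤ Σ_{i<I} sup_a |Δ(Λ; ⌊x/2^i⌋) − Δ(Λ; ⌊x/2^i/2⌋)| + sup_a |Δ(Λ; ⌊x/2^I⌋)|` (`q ≥ 1`). [folklore] -/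
theorem iSup_abs_apDiscrepancy_le_dyadic (x : ℝ) (I : ℕ) (q : ℕ) :
    (⨆ a : (ZMod q)ˣ, |apDiscrepancy (fun n => (Λ n : ℝ)) ⌊x⌋₊ q a|) ≤
      ∑ i ∈ range I, (⨆ a : (ZMod q)ˣ,
        |apDiscrepancy (fun n => (Λ n : ℝ)) ⌊x / 2 ^ i⌋₊ q a -
          apDiscrepancy (fun n => (Λ n : ℝ)) ⌊x / 2 ^ i / 2⌋₊ q a|) +
      ⨆ a : (ZMod q)ˣ, |apDiscrepancy (fun n => (Λ n : ℝ)) ⌊x / 2 ^ I⌋₊ q a| := by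
  haveI : Nonempty (ZMod q)ˣ := ⟨1⟩
  refine ciSup_le fun a => ?_
  set f : ℕ → ℝ := fun i => apDiscrepancy (fun n => (Λ n : ℝ)) ⌊x / 2 ^ i⌋₊ q a with hf
  have htel : f 0 = ∑ i ∈ range I, (f i - f (i + 1)) + f I := by
    rw [Finset.sum_range_sub']; ring
  have h0 : apDiscrepancy (fun n => (Λ n : ℝ)) ⌊x⌋₊ q a = f 0 := by
    rw [hf]; simp only [pow_zero, div_one]
  rw [h0, htel]
  refine (abs_add_le _ _).trans (add_le_add ?_ ?_)
  · refine (Finset.abs_sum_le_sum_abs _ _).trans (Finset.sum_le_sum fun i _ => ?_)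
    have e : f i - f (i + 1) = apDiscrepancy (fun n => (Λ n : ℝ)) ⌊x / 2 ^ i⌋₊ q a -
        apDiscrepancy (fun n => (Λ n : ℝ)) ⌊x / 2 ^ i / 2⌋₊ q a := by
      rw [hf]; simp only; rw [floor_half_pow]
    rw [e]
    exact le_supDisc' x i a
  · exact le_ciSup (Set.finite_range fun b : (ZMod q)ˣ =>
      |apDiscrepancy (fun n => (Λ n : ℝ)) ⌊x / 2 ^ I⌋₊ q b|).bddAbove a
where
  /-- each class is below the supremum (auxiliary) [folklore] -/
  le_supDisc' (x : ℝ) (i : ℕ) {q : ℕ} (a : (ZMod q)ˣ) :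
      |apDiscrepancy (fun n => (Λ n : ℝ)) ⌊x / 2 ^ i⌋₊ q a -
          apDiscrepancy (fun n => (Λ n : ℝ)) ⌊x / 2 ^ i / 2⌋₊ q a| ≤
        ⨆ b : (ZMod q)ˣ, |apDiscrepancy (fun n => (Λ n : ℝ)) ⌊x / 2 ^ i⌋₊ q b -
          apDiscrepancy (fun n => (Λ n : ℝ)) ⌊x / 2 ^ i / 2⌋₊ q b| :=
    le_ciSup (Set.finite_range fun b : (ZMod q)ˣ =>
      |apDiscrepancy (fun n => (Λ n : ℝ)) ⌊x / 2 ^ i⌋₊ q b -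
        apDiscrepancy (fun n => (Λ n : ℝ)) ⌊x / 2 ^ i / 2⌋₊ q b|).bddAbove a

/-! ### The tail -/

/-- **Trivial bound for the discrepancy of `Λ`**: for `q ≥ 1` and `M ≥ 1`,
`|Δ(Λ; M; a (q))| ≤ log M (M/q + 1) + (log 4 + 4) M / φ(q)`. [folklore] -/
theorem abs_apDiscrepancy_vonMangoldt_le_trivial {q : ℕ} (hq : 1 ≤ q) (a : (ZMod q)ˣ) {M : ℕ} (hM : 1 ≤ M) :
    |apDiscrepancy (fun n => (Λ n : ℝ)) M q a| ≤
      Real.log M * ((M : ℝ) / q + 1) + (Real.log 4 + 4) * M / Nat.totient q := by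
  have hφ0 : (0 : ℝ) < Nat.totient q := by exact_mod_cast Nat.totient_pos.2 (by omega)
  unfold apDiscrepancy
  set S₁ := ∑ n ∈ (Icc 1 M).filter (fun n : ℕ => (n : ZMod q) = a), (Λ n : ℝ) with hS₁
  set S₂ := ∑ n ∈ (Icc 1 M).filter (fun n : ℕ => n.Coprime q), (Λ n : ℝ) with hS₂
  have h1 : 0 ≤ S₁ := Finset.sum_nonneg fun _ _ => ArithmeticFunction.vonMangoldt_nonneg
  have h2 : 0 ≤ S₂ := Finset.sum_nonneg fun _ _ => ArithmeticFunction.vonMangoldt_nonneg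
  have h3 : S₁ ≤ Real.log M * ((M : ℝ) / q + 1) := by
    have e : S₁ = LevelOfDistribution.chebyshevPsiMod q a M := by
      have := chebyshevPsiMod_eq_sum_filter q a M
      rw [Nat.floor_natCast] at this
      rw [hS₁, ← this]; rfl
    rw [e]
    exact BFI.chebyshevPsiMod_le_log_mul hq (a : ZMod q) (by exact_mod_cast hM)
  have h4 : S₂ ≤ (Real.log 4 + 4) * M := by
    calc S₂ ≤ ∑ n ∈ Icc 1 M, (Λ n : ℝ) :=
          Finset.sum_le_sum_of_subset_of_nonneg (Finset.filter_subset _ _)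
            fun _ _ _ => ArithmeticFunction.vonMangoldt_nonneg
      _ = Chebyshev.psi M := by rw [Chebyshev.psi, Nat.floor_natCast]; rfl
      _ ≤ (Real.log 4 + 4) * M := Chebyshev.psi_le_const_mul_self (Nat.cast_nonneg _)
  rw [abs_le]
  constructor
  · have : S₂ / Nat.totient q ≤ (Real.log 4 + 4) * M / Nat.totient q := div_le_div_of_nonneg_right h4 hφ0.le
    have : 0 ≤ Real.log M * ((M : ℝ) / q + 1) := by
      have : 0 ≤ Real.log (M : ℝ) := Real.log_natCast_nonneg M
      positivity
    nlinarith [div_nonneg h2 hφ0.le]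
  · have : 0 ≤ (Real.log 4 + 4) * M / Nat.totient q := by
      have : 0 < Real.log 4 := Real.log_pos (by norm_num)
      positivity
    nlinarith [div_nonneg h2 hφ0.le]

/-- **The tail, summed over the moduli**: for `Q, M ≥ 1`,
`Σ_{q ≤ Q} sup_a |Δ(Λ; M; a (q))| ≤ M log M (1 + log Q) + Q log M + (log 4 + 4) M (1 + log Q)²`. [folklore] -/
theorem sum_iSup_abs_apDiscrepancy_tail_le {Q M : ℕ} (hM : 1 ≤ M) :
    ∑ q ∈ Icc 1 Q, (⨆ a : (ZMod q)ˣ, |apDiscrepancy (fun n => (Λ n : ℝ)) M q a|) ≤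
      M * Real.log M * (1 + Real.log Q) + Q * Real.log M + (Real.log 4 + 4) * M * (1 + Real.log Q) ^ 2 := by
  have hlogM : 0 ≤ Real.log (M : ℝ) := Real.log_natCast_nonneg M
  have hlog4 : 0 < Real.log 4 := Real.log_pos (by norm_num)
  have step : ∀ q ∈ Icc 1 Q, (⨆ a : (ZMod q)ˣ, |apDiscrepancy (fun n => (Λ n : ℝ)) M q a|) ≤
      Real.log M * ((M : ℝ) / q + 1) + (Real.log 4 + 4) * M / Nat.totient q := by
    intro q hq
    rw [Finset.mem_Icc] at hq
    haveI : NeZero q := ⟨by omega⟩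
    haveI : Nonempty (ZMod q)ˣ := ⟨1⟩
    exact ciSup_le fun a => abs_apDiscrepancy_vonMangoldt_le_trivial hq.1 a hM
  refine (Finset.sum_le_sum step).trans ?_
  rw [Finset.sum_add_distrib]
  -- harmonic and totient sums
  have hH : ∑ q ∈ Icc 1 Q, (1 : ℝ) / q ≤ 1 + Real.log Q := by
    rcases Nat.eq_zero_or_pos Q with rfl | hQ
    · simp
    · have h1 : ∑ q ∈ Icc 1 Q, (1 : ℝ) / q = harmonic Q := by
        rw [harmonic_eq_sum_Icc]; push_cast
        exact Finset.sum_congr rfl fun q _ => by rw [one_div]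
      rw [h1]; exact harmonic_le_one_add_log Q
  have hφ := sum_Icc_one_div_totient_le_sq Q
  have e1 : ∑ q ∈ Icc 1 Q, Real.log M * ((M : ℝ) / q + 1) =
      M * Real.log M * ∑ q ∈ Icc 1 Q, (1 : ℝ) / q + Q * Real.log M := by
    have : ∀ q ∈ Icc 1 Q, Real.log M * ((M : ℝ) / q + 1) = M * Real.log M * (1 / q) + Real.log M :=
      fun q _ => by ring
    rw [Finset.sum_congr rfl this, Finset.sum_add_distrib, ← Finset.mul_sum, Finset.sum_const, Nat.card_Icc,
      add_tsub_cancel_right, nsmul_eq_mul]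
  have e2 : ∑ q ∈ Icc 1 Q, (Real.log 4 + 4) * M / Nat.totient q =
      (Real.log 4 + 4) * M * ∑ q ∈ Icc 1 Q, (1 : ℝ) / Nat.totient q := by
    rw [Finset.mul_sum]
    exact Finset.sum_congr rfl fun q _ => by ring
  rw [e1, e2]
  have t1 : (M : ℝ) * Real.log M * ∑ q ∈ Icc 1 Q, (1 : ℝ) / q ≤ M * Real.log M * (1 + Real.log Q) :=
    mul_le_mul_of_nonneg_left hH (by positivity)
  have t2 : (Real.log 4 + 4) * M * ∑ q ∈ Icc 1 Q, (1 : ℝ) / Nat.totient q ≤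
      (Real.log 4 + 4) * M * (1 + Real.log Q) ^ 2 :=
    mul_le_mul_of_nonneg_left hφ (by positivity)
  linarith

/-! ### `EH[θ]` from `GEH` -/

/-- Monotonicity of `EH` in the level. [folklore] -/
theorem eh_mono {θ θ' : ℝ} (hθ : θ ≤ θ') (h : EH θ') : EH θ := by
  intro A
  refine IsBigO.trans ?_ (h A)
  refine IsBigO.of_bound 1 ?_
  filter_upwards [eventually_ge_atTop (1 : ℝ)] with x hx
  have hsub : Icc 1 ⌊x ^ θ⌋₊ ⊆ Icc 1 ⌊x ^ θ'⌋₊ :=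
    Finset.Icc_subset_Icc_right (Nat.floor_le_floor (Real.rpow_le_rpow_of_exponent_le hx hθ))
  have hnn : ∀ q ∈ Icc 1 ⌊x ^ θ'⌋₊,
      0 ≤ ⨆ a : (ZMod q)ˣ, |ParityWave0.chebyshevPsiMod q a x - x / Nat.totient q| :=
    fun q _ => Real.iSup_nonneg fun _ => abs_nonneg _
  rw [one_mul, Real.norm_of_nonneg (Finset.sum_nonneg fun q hq => hnn q (hsub hq)),
    Real.norm_of_nonneg (Finset.sum_nonneg hnn)]
  exact Finset.sum_le_sum_of_subset_of_nonneg hsub fun q hq _ => hnn q hq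

/-- The window sums dominate: if `x^κ ≤ X` with `κ ϑ' = θ`, the sum over `q ≤ x^θ` of the window
suprema at `X` is at most the sum over `q ≤ X^{ϑ'}`. [folklore] -/
theorem sum_window_le_of_le {θ ϑ' κ : ℝ} (hϑ' : 0 < ϑ') (hκθ : κ * ϑ' = θ) {x X : ℝ} (hx : 0 ≤ x)
    (hX : x ^ κ ≤ X) :
    ∑ q ∈ Icc 1 ⌊x ^ θ⌋₊, (⨆ a : (ZMod q)ˣ,
        |apDiscrepancy (fun n => (Λ n : ℝ)) ⌊X⌋₊ q a - apDiscrepancy (fun n => (Λ n : ℝ)) ⌊X / 2⌋₊ q a|) ≤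
      ∑ q ∈ Icc 1 ⌊X ^ ϑ'⌋₊, (⨆ a : (ZMod q)ˣ,
        |apDiscrepancy (fun n => (Λ n : ℝ)) ⌊X⌋₊ q a - apDiscrepancy (fun n => (Λ n : ℝ)) ⌊X / 2⌋₊ q a|) := by
  have hxκ : 0 ≤ x ^ κ := Real.rpow_nonneg hx _
  have h1 : x ^ θ ≤ X ^ ϑ' := by
    rw [← hκθ, Real.rpow_mul hx]
    exact Real.rpow_le_rpow hxκ hX hϑ'.le
  refine Finset.sum_le_sum_of_subset_of_nonneg (Finset.Icc_subset_Icc_right (Nat.floor_le_floor h1)) ?_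
  exact fun q _ _ => Real.iSup_nonneg fun _ => abs_nonneg _

set_option maxHeartbeats 1600000 in
-- one long assembly with explicit constants (five estimates and their eventual absorptions)
/-- **Proposition 2.7, main case**: `GEH[(1+θ)/2]` implies `EH[θ]` for `0 < θ < 1`.
[cite: Polymath8b2014, Proposition 2.7] -/
theorem eh_of_geh_pos {θ : ℝ} (hθ0 : 0 < θ) (hθ1 : θ < 1)
    (hGEH : GeneralizedElliottHalberstam ((1 + θ) / 2)) : EH θ := by
  -- reduce to exponents `A > 0`
  suffices hpos : ∀ A : ℝ, 0 < A →
      (fun x : ℝ => ∑ q ∈ Icc 1 ⌊x ^ θ⌋₊,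
        ⨆ a : (ZMod q)ˣ, |ParityWave0.chebyshevPsiMod q a x - x / Nat.totient q|) =O[atTop]
      fun x : ℝ => x / Real.log x ^ A by
    intro A
    refine (hpos (max A 1) (lt_of_lt_of_le one_pos (le_max_right _ _))).trans ?_
    refine IsBigO.of_bound 1 ?_
    filter_upwards [eventually_ge_atTop (Real.exp 1)] with x hx
    have hx0 : 0 < x := lt_of_lt_of_le (Real.exp_pos 1) hx
    have hL : 1 ≤ Real.log x := by rwa [Real.le_log_iff_exp_le hx0]
    rw [one_mul, Real.norm_of_nonneg (by positivity), Real.norm_of_nonneg (by positivity)]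
    exact div_le_div_of_nonneg_left hx0.le (Real.rpow_pos_of_pos (by linarith) _)
      (Real.rpow_le_rpow_of_exponent_le hL (le_max_left _ _))
  intro A hA
  -- parameters
  set ϑ' : ℝ := (1 + θ) / 2 with hϑ'
  have hϑ'0 : 0 < ϑ' := by rw [hϑ']; linarith
  have hϑ'1 : ϑ' < 1 := by rw [hϑ']; linarith
  set κ : ℝ := θ / ϑ' with hκ
  have hκθ : κ * ϑ' = θ := by rw [hκ]; field_simp
  have hκ0 : 0 < κ := div_pos hθ0 hϑ'0
  have hκ1 : κ < 1 := by rw [hκ, div_lt_one hϑ'0, hϑ']; linarith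
  have hθκ : θ < κ := by
    rw [hκ, lt_div_iff₀ hϑ'0, hϑ']; nlinarith
  -- the window bound and the prime number theorem
  obtain ⟨C_W, hW⟩ := ehWindow_of_geh hϑ'0 hϑ'1 hGEH hA
  obtain ⟨X₀, hX₀⟩ := eventually_atTop.1 hW
  obtain ⟨C_P, hP⟩ := (Literature.NumberTheory.LFunctions.PsiLogPower.chebyshevPsi_sub_self_isBigO_div_logPow (A + 2)).bound
  set CW : ℝ := max C_W 0 with hCW
  set CP : ℝ := max C_P 0 with hCP
  refine IsBigO.of_bound (2 * CW * κ ^ (-A) + 1 + (4 * CP + 1)) ?_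
  -- eventual conditions
  have e1 : ∀ᶠ x : ℝ in atTop, max X₀ 2 ≤ x ^ κ := (tendsto_rpow_atTop hκ0).eventually_ge_atTop _
  have e2 : ∀ᶠ x : ℝ in atTop, Real.exp 1 ≤ x := eventually_ge_atTop _
  have e3 : ∀ᶠ x : ℝ in atTop, 27 * Real.log x ^ (A + 2) ≤ x ^ (1 - κ) := by
    have := (isLittleO_log_rpow_rpow_atTop (A + 2) (by linarith : 0 < 1 - κ)).bound (show (0:ℝ) < 1 / 27 by norm_num)
    filter_upwards [this, eventually_ge_atTop (1 : ℝ)] with x hx hx1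
    rw [Real.norm_of_nonneg (Real.rpow_nonneg (Real.log_nonneg hx1) _),
      Real.norm_of_nonneg (Real.rpow_nonneg (by linarith) _)] at hx
    linarith
  have e4 : ∀ᶠ x : ℝ in atTop, 8 * Real.log x ^ (A + 4) ≤ x := by
    have := (isLittleO_log_rpow_rpow_atTop (A + 4) zero_lt_one).bound (show (0:ℝ) < 1 / 8 by norm_num)
    filter_upwards [this, eventually_ge_atTop (1 : ℝ)] with x hx hx1
    rw [Real.norm_of_nonneg (Real.rpow_nonneg (Real.log_nonneg hx1) _),
      Real.norm_of_nonneg (Real.rpow_nonneg (by linarith) _), Real.rpow_one] at hx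
    linarith
  filter_upwards [e1, e2, e3, e4, hP] with x hx1 hx2 hx3 hx4 hPx
  -- basic facts
  have hx0 : 0 < x := lt_of_lt_of_le (Real.exp_pos 1) hx2
  have hx1' : 1 ≤ x := le_trans (by have := Real.add_one_le_exp (1:ℝ); linarith) hx2
  have hL1 : 1 ≤ Real.log x := by rwa [Real.le_log_iff_exp_le hx0]
  have hL0 : 0 < Real.log x := by linarith
  set L := Real.log x with hLdef
  have hLA : 0 < L ^ A := Real.rpow_pos_of_pos hL0 A
  have hXκ : X₀ ≤ x ^ κ := (le_max_left _ _).trans hx1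
  have h2κ : (2 : ℝ) ≤ x ^ κ := (le_max_right _ _).trans hx1
  have hxκx : x ^ κ ≤ x := by
    calc x ^ κ ≤ x ^ (1 : ℝ) := Real.rpow_le_rpow_of_exponent_le hx1' hκ1.le
      _ = x := Real.rpow_one x
  set Q := ⌊x ^ θ⌋₊ with hQ
  have hQx : (Q : ℝ) ≤ x := (Nat.floor_le (Real.rpow_nonneg hx0.le _)).trans
    ((Real.rpow_le_rpow_of_exponent_le hx1' hθ1.le).trans (Real.rpow_one x).le)
  have hQθ : (Q : ℝ) ≤ x ^ θ := Nat.floor_le (Real.rpow_nonneg hx0.le _)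
  have hlogQ : Real.log Q ≤ L := by
    rcases Nat.eq_zero_or_pos Q with h0 | h0
    · rw [h0]; simp; linarith
    · exact Real.log_le_log (by exact_mod_cast h0) hQx
  have hlogQ0 : 0 ≤ Real.log Q := Real.log_natCast_nonneg Q
  -- Step 1: from `ψ` to `Δ`
  have hnn : 0 ≤ ∑ q ∈ Icc 1 Q, ⨆ a : (ZMod q)ˣ, |ParityWave0.chebyshevPsiMod q a x - x / Nat.totient q| :=
    Finset.sum_nonneg fun q _ => Real.iSup_nonneg fun _ => abs_nonneg _
  rw [Real.norm_of_nonneg hnn, Real.norm_of_nonneg (by positivity)]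
  have step1 : ∑ q ∈ Icc 1 Q, (⨆ a : (ZMod q)ˣ, |ParityWave0.chebyshevPsiMod q a x - x / Nat.totient q|) ≤
      ∑ q ∈ Icc 1 Q, (⨆ a : (ZMod q)ˣ, |apDiscrepancy (fun n => (Λ n : ℝ)) ⌊x⌋₊ q a|) +
        (|Chebyshev.psi x - x| + 2 * L ^ 2) * ∑ q ∈ Icc 1 Q, 1 / (Nat.totient q : ℝ) := by
    rw [Finset.mul_sum, ← Finset.sum_add_distrib]
    refine Finset.sum_le_sum fun q hq => ?_
    rw [Finset.mem_Icc] at hq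
    haveI : Nonempty (ZMod q)ˣ := ⟨1⟩
    have hqx : (q : ℝ) ≤ x := le_trans (by exact_mod_cast hq.2) hQx
    refine ciSup_le fun a => (abs_chebyshevPsiMod_sub_le hq.1 a hx1' hqx).trans ?_
    rw [mul_one_div]
    exact add_le_add (le_ciSup (Set.finite_range fun b : (ZMod q)ˣ =>
      |apDiscrepancy (fun n => (Λ n : ℝ)) ⌊x⌋₊ q b|).bddAbove a) le_rfl
  -- Step 2: the PNT part
  have step2 : (|Chebyshev.psi x - x| + 2 * L ^ 2) * ∑ q ∈ Icc 1 Q, 1 / (Nat.totient q : ℝ) ≤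
      (4 * CP + 1) * (x / L ^ A) := by
    have hφ := sum_Icc_one_div_totient_le_sq Q
    have hφ' : ∑ q ∈ Icc 1 Q, 1 / (Nat.totient q : ℝ) ≤ 4 * L ^ 2 := by
      have h1 : 1 + Real.log Q ≤ 2 * L := by linarith
      have h0 : 0 ≤ 1 + Real.log Q := by linarith
      calc ∑ q ∈ Icc 1 Q, 1 / (Nat.totient q : ℝ) ≤ (1 + Real.log Q) ^ 2 := hφ
        _ ≤ (2 * L) ^ 2 := pow_le_pow_left₀ h0 h1 2
        _ = 4 * L ^ 2 := by ring
    have hψ : |Chebyshev.psi x - x| ≤ CP * (x / L ^ (A + 2)) := by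
      rw [Real.norm_eq_abs, Real.norm_of_nonneg (by positivity)] at hPx
      exact hPx.trans (mul_le_mul_of_nonneg_right (le_max_left _ _) (by positivity))
    have hA2 : L ^ (A + 2) = L ^ A * L ^ 2 := by
      rw [Real.rpow_add hL0]; congr 1; exact_mod_cast Real.rpow_natCast L 2
    have hA4 : L ^ (A + 4) = L ^ A * L ^ 4 := by
      rw [Real.rpow_add hL0]; congr 1; exact_mod_cast Real.rpow_natCast L 4
    have t1 : CP * (x / L ^ (A + 2)) * (4 * L ^ 2) = 4 * CP * (x / L ^ A) := by
      rw [hA2]; field_simp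
    have t2 : 2 * L ^ 2 * (4 * L ^ 2) ≤ x / L ^ A := by
      rw [le_div_iff₀ hLA]
      rw [hA4] at hx4
      have e : 2 * L ^ 2 * (4 * L ^ 2) * L ^ A = 8 * (L ^ A * L ^ 4) := by ring
      rw [e]; exact hx4
    have hs0 : 0 ≤ ∑ q ∈ Icc 1 Q, 1 / (Nat.totient q : ℝ) := Finset.sum_nonneg fun _ _ => by positivity
    calc (|Chebyshev.psi x - x| + 2 * L ^ 2) * ∑ q ∈ Icc 1 Q, 1 / (Nat.totient q : ℝ)
        ≤ (CP * (x / L ^ (A + 2)) + 2 * L ^ 2) * (4 * L ^ 2) :=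
          mul_le_mul (add_le_add hψ le_rfl) hφ' hs0 (by positivity)
      _ = 4 * CP * (x / L ^ A) + 2 * L ^ 2 * (4 * L ^ 2) := by rw [add_mul, t1]
      _ ≤ 4 * CP * (x / L ^ A) + x / L ^ A := add_le_add le_rfl t2
      _ = (4 * CP + 1) * (x / L ^ A) := by ring
  -- Step 3: dyadic decomposition of `Δ(⌊x⌋)`
  set I : ℕ := ⌈(1 - κ) * L / Real.log 2⌉₊ with hI
  have hlog2 : 0 < Real.log 2 := Real.log_pos (by norm_num)
  have hI1 : (1 - κ) * L ≤ I * Real.log 2 := by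
    have := Nat.le_ceil ((1 - κ) * L / Real.log 2)
    rw [← hI, div_le_iff₀ hlog2] at this; exact this
  have hI2 : ((I : ℝ) - 1) * Real.log 2 < (1 - κ) * L := by
    have := Nat.ceil_lt_add_one (show 0 ≤ (1 - κ) * L / Real.log 2 by
      exact div_nonneg (mul_nonneg (by linarith) hL0.le) hlog2.le)
    rw [← hI] at this
    have : (I : ℝ) - 1 < (1 - κ) * L / Real.log 2 := by linarith
    rwa [lt_div_iff₀ hlog2] at this
  -- `x / 2^I ≤ x^κ` and `x / 2^i > x^κ` for `i < I`
  have hpow2 : ∀ n : ℕ, ((2 : ℝ) ^ n) = Real.exp (n * Real.log 2) := by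
    intro n; rw [← Real.exp_log (pow_pos (by norm_num : (0:ℝ) < 2) n), Real.log_pow]
  have hxsplit : x = x ^ κ * x ^ (1 - κ) := by
    rw [← Real.rpow_add hx0]; ring_nf; exact (Real.rpow_one x).symm
  have hx1κ : x ^ (1 - κ) = Real.exp ((1 - κ) * L) := by
    rw [Real.rpow_def_of_pos hx0, hLdef]; ring_nf
  have hM_le : x / 2 ^ I ≤ x ^ κ := by
    rw [div_le_iff₀ (pow_pos (by norm_num) _), hpow2]
    calc x = x ^ κ * Real.exp ((1 - κ) * L) := by rw [← hx1κ]; exact hxsplit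
      _ ≤ x ^ κ * Real.exp (I * Real.log 2) :=
          mul_le_mul_of_nonneg_left (Real.exp_le_exp.2 hI1) (Real.rpow_nonneg hx0.le _)
  have hXi : ∀ i < I, x ^ κ ≤ x / 2 ^ i := by
    intro i hi
    rw [le_div_iff₀ (pow_pos (by norm_num) _), hpow2]
    have hi' : (i : ℝ) ≤ I - 1 := by
      have : i + 1 ≤ I := hi
      have : ((i + 1 : ℕ) : ℝ) ≤ I := by exact_mod_cast this
      push_cast at this; linarith
    calc x ^ κ * Real.exp (i * Real.log 2) ≤ x ^ κ * Real.exp ((I - 1) * Real.log 2) :=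
          mul_le_mul_of_nonneg_left (Real.exp_le_exp.2 (mul_le_mul_of_nonneg_right hi' hlog2.le))
            (Real.rpow_nonneg hx0.le _)
      _ ≤ x ^ κ * Real.exp ((1 - κ) * L) :=
          mul_le_mul_of_nonneg_left (Real.exp_le_exp.2 hI2.le) (Real.rpow_nonneg hx0.le _)
      _ = x := by rw [← hx1κ]; exact hxsplit.symm
  have step3 : ∑ q ∈ Icc 1 Q, (⨆ a : (ZMod q)ˣ, |apDiscrepancy (fun n => (Λ n : ℝ)) ⌊x⌋₊ q a|) ≤
      ∑ i ∈ range I, ∑ q ∈ Icc 1 Q, (⨆ a : (ZMod q)ˣ,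
        |apDiscrepancy (fun n => (Λ n : ℝ)) ⌊x / 2 ^ i⌋₊ q a -
          apDiscrepancy (fun n => (Λ n : ℝ)) ⌊x / 2 ^ i / 2⌋₊ q a|) +
      ∑ q ∈ Icc 1 Q, (⨆ a : (ZMod q)ˣ, |apDiscrepancy (fun n => (Λ n : ℝ)) ⌊x / 2 ^ I⌋₊ q a|) := by
    rw [Finset.sum_comm, ← Finset.sum_add_distrib]
    exact Finset.sum_le_sum fun q _ => iSup_abs_apDiscrepancy_le_dyadic x I q
  -- Step 4: the windows
  have step4 : ∑ i ∈ range I, ∑ q ∈ Icc 1 Q, (⨆ a : (ZMod q)ˣ,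
        |apDiscrepancy (fun n => (Λ n : ℝ)) ⌊x / 2 ^ i⌋₊ q a -
          apDiscrepancy (fun n => (Λ n : ℝ)) ⌊x / 2 ^ i / 2⌋₊ q a|) ≤
      2 * CW * κ ^ (-A) * (x / L ^ A) := by
    have hterm : ∀ i ∈ range I, ∑ q ∈ Icc 1 Q, (⨆ a : (ZMod q)ˣ,
        |apDiscrepancy (fun n => (Λ n : ℝ)) ⌊x / 2 ^ i⌋₊ q a -
          apDiscrepancy (fun n => (Λ n : ℝ)) ⌊x / 2 ^ i / 2⌋₊ q a|) ≤
        CW * κ ^ (-A) * (x / L ^ A) * (1 / 2 ^ i) := by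
      intro i hi
      rw [Finset.mem_range] at hi
      have hXi' := hXi i hi
      have hX0' : X₀ ≤ x / 2 ^ i := hXκ.trans hXi'
      have hXpos : 0 < x / 2 ^ i := by positivity
      refine (sum_window_le_of_le hϑ'0 hκθ hx0.le hXi').trans ?_
      refine (hX₀ _ hX0').trans ?_
      -- `C_W X / log^A X ≤ CW κ^{-A} (x/L^A)/2^i` with `X = x/2^i`, `log X ≥ κ L`
      have hlogX : κ * L ≤ Real.log (x / 2 ^ i) := by
        have : Real.log (x ^ κ) = κ * L := by rw [Real.log_rpow hx0]
        rw [← this]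
        exact Real.log_le_log (by positivity) hXi'
      have hκL : 0 < κ * L := mul_pos hκ0 hL0
      have hlogXA : (κ * L) ^ A ≤ Real.log (x / 2 ^ i) ^ A := Real.rpow_le_rpow hκL.le hlogX hA.le
      have hκLA : 0 < (κ * L) ^ A := Real.rpow_pos_of_pos hκL A
      calc C_W * (x / 2 ^ i) / Real.log (x / 2 ^ i) ^ A
          ≤ CW * (x / 2 ^ i) / Real.log (x / 2 ^ i) ^ A := by
            refine div_le_div_of_nonneg_right (mul_le_mul_of_nonneg_right (le_max_left _ _) hXpos.le) ?_
            exact Real.rpow_nonneg ((mul_nonneg hκ0.le hL0.le).trans hlogX) _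
        _ ≤ CW * (x / 2 ^ i) / (κ * L) ^ A :=
            div_le_div_of_nonneg_left (by positivity) hκLA hlogXA
        _ = CW * κ ^ (-A) * (x / L ^ A) * (1 / 2 ^ i) := by
            rw [Real.mul_rpow hκ0.le hL0.le, Real.rpow_neg hκ0.le]
            field_simp
    refine (Finset.sum_le_sum hterm).trans ?_
    rw [← Finset.mul_sum]
    have hgeom : ∑ i ∈ range I, (1 : ℝ) / 2 ^ i ≤ 2 := by
      have := geom_sum_Ico_le_of_lt_one (x := (1/2 : ℝ)) (by norm_num) (by norm_num) (m := 0) (n := I)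
      simp only [Finset.range_eq_Ico, pow_zero] at this ⊢
      have e : ∀ i, (1 : ℝ) / 2 ^ i = (1 / 2) ^ i := fun i => by rw [div_pow, one_pow]
      simp only [e]
      refine this.trans (by norm_num)
    have h0 : 0 ≤ CW * κ ^ (-A) * (x / L ^ A) := by positivity
    calc CW * κ ^ (-A) * (x / L ^ A) * ∑ i ∈ range I, (1 : ℝ) / 2 ^ i
        ≤ CW * κ ^ (-A) * (x / L ^ A) * 2 := mul_le_mul_of_nonneg_left hgeom h0
      _ = 2 * CW * κ ^ (-A) * (x / L ^ A) := by ring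
  -- Step 5: the tail
  have step5 : ∑ q ∈ Icc 1 Q, (⨆ a : (ZMod q)ˣ, |apDiscrepancy (fun n => (Λ n : ℝ)) ⌊x / 2 ^ I⌋₊ q a|) ≤
      x / L ^ A := by
    set M := ⌊x / 2 ^ I⌋₊ with hM
    have hMκ : (M : ℝ) ≤ x ^ κ := (Nat.floor_le (by positivity)).trans hM_le
    have hM1 : 1 ≤ M := by
      -- `x/2^I > x^κ/2 ≥ 1`
      have : x ^ κ / 2 ≤ x / 2 ^ I := by
        rcases Nat.eq_zero_or_pos I with h0 | hIpos
        · rw [h0, pow_zero, div_one]; linarith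
        · have := hXi (I - 1) (by omega)
          calc x ^ κ / 2 ≤ (x / 2 ^ (I - 1)) / 2 := div_le_div_of_nonneg_right this (by norm_num)
            _ = x / 2 ^ I := by rw [div_div, ← pow_succ, Nat.sub_add_cancel hIpos]
      exact Nat.le_floor (by rw [Nat.cast_one]; linarith)
    have hlogM : Real.log M ≤ L := by
      refine Real.log_le_log (by exact_mod_cast hM1) (hMκ.trans hxκx)
    have hlogM0 : 0 ≤ Real.log (M : ℝ) := Real.log_natCast_nonneg M
    refine (sum_iSup_abs_apDiscrepancy_tail_le (Q := Q) hM1).trans ?_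
    have hlog4 : Real.log 4 + 4 ≤ 6 := by
      have := Real.log_two_lt_d9
      rw [show (4 : ℝ) = 2 ^ 2 by norm_num, Real.log_pow]; push_cast; linarith
    have hxθκ : x ^ θ ≤ x ^ κ := Real.rpow_le_rpow_of_exponent_le hx1' hθκ.le
    have hM0 : (0 : ℝ) ≤ M := Nat.cast_nonneg _
    -- bound each term by a multiple of `x^κ L²`
    have u1 : (M : ℝ) * Real.log M * (1 + Real.log Q) ≤ x ^ κ * L * (2 * L) := by
      refine mul_le_mul (mul_le_mul hMκ hlogM hlogM0 (by positivity)) (by linarith) (by positivity) (by positivity)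
    have u2 : (Q : ℝ) * Real.log M ≤ x ^ κ * L := mul_le_mul (hQθ.trans hxθκ) hlogM hlogM0 (by positivity)
    have u3 : (Real.log 4 + 4) * M * (1 + Real.log Q) ^ 2 ≤ 6 * x ^ κ * (2 * L) ^ 2 := by
      have : (1 + Real.log Q) ^ 2 ≤ (2 * L) ^ 2 := pow_le_pow_left₀ (by positivity) (by linarith) 2
      refine mul_le_mul (mul_le_mul hlog4 hMκ hM0 (by norm_num)) this (by positivity) (by positivity)
    have u4 : x ^ κ * L * (2 * L) + x ^ κ * L + 6 * x ^ κ * (2 * L) ^ 2 ≤ 27 * L ^ 2 * x ^ κ := by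
      have h1 : x ^ κ * L ≤ x ^ κ * L ^ 2 := by
        rw [sq]; exact mul_le_mul_of_nonneg_left (le_mul_of_one_le_right hL0.le hL1) (by positivity)
      calc x ^ κ * L * (2 * L) + x ^ κ * L + 6 * x ^ κ * (2 * L) ^ 2 = 26 * (x ^ κ * L ^ 2) + x ^ κ * L := by ring
        _ ≤ 26 * (x ^ κ * L ^ 2) + x ^ κ * L ^ 2 := by linarith
        _ = 27 * L ^ 2 * x ^ κ := by ring
    -- `27 L² x^κ ≤ x / L^A`
    have u5 : 27 * L ^ 2 * x ^ κ ≤ x / L ^ A := by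
      rw [le_div_iff₀ hLA]
      have hA2 : L ^ (A + 2) = L ^ A * L ^ 2 := by
        rw [Real.rpow_add hL0]; congr 1; exact_mod_cast Real.rpow_natCast L 2
      calc 27 * L ^ 2 * x ^ κ * L ^ A = (27 * L ^ (A + 2)) * x ^ κ := by rw [hA2]; ring
        _ ≤ x ^ (1 - κ) * x ^ κ := mul_le_mul_of_nonneg_right hx3 (Real.rpow_nonneg hx0.le _)
        _ = x := by rw [mul_comm]; exact hxsplit.symm
    linarith
  -- assemble
  have e : (2 * CW * κ ^ (-A) + 1 + (4 * CP + 1)) * (x / L ^ A) =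
      2 * CW * κ ^ (-A) * (x / L ^ A) + x / L ^ A + (4 * CP + 1) * (x / L ^ A) := by ring
  rw [e]
  linarith [step1, step2, step3, step4, step5]

/-- **Proposition 2.7 (Polymath 8b)**: `GEH[ϑ]` for all `0 < ϑ < 1` implies `EH[θ]` for all `θ < 1`.
[cite: Polymath8b2014, Proposition 2.7] -/
theorem eh_of_forall_geh (h : ∀ ϑ : ℝ, 0 < ϑ → ϑ < 1 → GeneralizedElliottHalberstam ϑ) {θ : ℝ}
    (hθ : θ < 1) : EH θ := by
  by_cases hθ0 : 0 < θ
  · exact eh_of_geh_pos hθ0 hθ (h _ (by linarith) (by linarith))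
  · refine eh_mono (show θ ≤ 1 / 2 by linarith) ?_
    exact eh_of_geh_pos (by norm_num) (by norm_num) (h _ (by norm_num) (by norm_num))

/-- **Corollary**: `GEH[ϑ]` for all `0 < ϑ < 1` implies that the primes have every level of
distribution `θ < 1` (`PrimesHaveLevel θ`), via the tree's `primesHaveLevel_of_forall_eh`.
[cite: Polymath8b2014, Proposition 2.7] -/
theorem primesHaveLevel_of_forall_geh (h : ∀ ϑ : ℝ, 0 < ϑ → ϑ < 1 → GeneralizedElliottHalberstam ϑ)
    {θ : ℝ} (hθ : θ < 1) : PrimesHaveLevel θ :=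
  primesHaveLevel_of_forall_eh (fun _ hθ' => eh_of_forall_geh h hθ') hθ

end GEHtoEH

end Literature.NumberTheory.Sieve
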